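import Summits.BirchSwinnertonDyer.BirchSwinnertonDyer.Theorems.ManinLocalTwoThreeNotTrivialEisensteinReduction
import Literature.NumberTheory.EllipticCurves.OpenImageMazurTwistProofs
import Literature.NumberTheory.EllipticCurves.GoodReductionUnramifiedProofs
import HarnessLib

/-!
# E-es-40 (odd `t`) from the TOTAL RAMIFICATION of `ℚ(ζ_{t^m})` at `t`: Theorem D and the assembled conclusion

Route `ManinLocalTwoThree` (cell bsd-f2-manin), crux C2 `ManinOddAtFour` (stmt-BirchSwinnertonDyer-22967), line `kato_shift_two` v8,
stub 5 `stub_notTrivialEisensteinTwo` (E-es-40).  After Theorem A/B (p612387: Chebotarev core; `t ≡ 2 (mod 3)`) and Theorem C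
(p613173: reduction to «∃ `g` fixing `ζ_{t^{M+1}}` and moving a point of `W[2]`»), this file proves that non-containment from the
ONE remaining input, the total ramification of `ℚ(ζ_{t^m})` at `t` in ELEMENT form «the inertia group `I_𝔓 ≤ Γ_ℚ` (`𝔓 ∣ t`) acts
transitively on the conjugates of `ζ`» (Washington, *Cyclotomic Fields*, Prop. 2.3 / Mathlib
`IsCyclotomicExtension.Rat.ramificationIdx_eq_of_prime_pow`, not yet in this element form in the tree):

* **Theorem D `exists_smul_eq_and_smul_ne_of_inertia_transitive`** — `W[2]` irreducible, `t` odd, `W` good or multiplicative at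
  the place over `t`, `I_𝔓` transitive on the conjugates of `ζ` ⟹ some `g` fixes `ζ` and moves a point of `W[2]`.  ELEMENT-LEVEL
  proof: else `Stab(ζ)` acts trivially on `W[2]`; commutators fix `ζ`, so every `g` commutes on `W[2]` with a fixed-point-free `τ`
  (irreducibility), and an element commuting with `τ` that fixes a non-zero point is trivial on `W[2]` (four-element structure,
  `eq_zero_or_eq_or_eq_or_eq_add`); inertia elements fix a non-zero point (good: `smul_geomTorsion_eq_of_mem_inertia`,
  Néron–Ogg–Shafarevich; multiplicative: `smul_smul_sub_eq_of_mem_inertia_geomPoints`, unipotence), hence act trivially; by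
  transitivity `τ ∈ I_𝔓 · Stab(ζ)` would act trivially — contradiction;
* **`exists_prime_modEq_one_lFunction_odd_of_inertia_transitive`** — E-es-40's conclusion (`r ∉ S`, `r ≡ 1 (mod t^M)`, `a_r(W)`
  odd) for `W` globally minimal, `t` odd of good or multiplicative reduction, modulo that transitivity.

What is left of stub 5 after this file: (i) the transitivity/total-ramification input (Literature-level, standard); (ii) the
routine bridge «`t = 2 ∨ t² ∤ N` for the newform level ⟹ good or multiplicative at `t`» (`IsNewformOf.dvd_level_iff_dvd_conductorNorm`,
`IsNewform0.cuspCoeff_sq_eq_one_of_dvd_of_not_sq_dvd`, `LFunction_apply_eq_zero_of_hasAdditiveReductionAt`) and the global-minimal-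
model reduction (`LFunction_smul`, `Mazur1978.hasIrreducibleModPGaloisRep_smul_iff`).  No new definitions; axioms standard; nothing
about BSD or Manin's conjecture is proved here.  References: J.-P. Serre, Invent. Math. 15 (1972) §4; J. Tate, GCFT §2.4;
L. Washington, *Introduction to Cyclotomic Fields*, Prop. 2.3; HOME/MEMO-es.md §25.1.
-/

set_option autoImplicit false
set_option linter.dupNamespace false

noncomputable section

open scoped Classical

open NumberField IsDedekindDomain Field WeierstrassCurve
  Literature.NumberTheory.EllipticCurves Literature.NumberTheory.GaloisRepresentations
  Summit.BirchSwinnertonDyer.Rank1Residual.ManinAdditive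

namespace Summit.BirchSwinnertonDyer.BirchSwinnertonDyer.Theorems.ManinLocalTwoThree

/-! ### §1  Theorem D: non-containment `ℚ(W[2]) ⊄ ℚ(ζ)` from inertia at `t` -/

section TheoremD

/-- **Theorem D.**  Let `W/ℚ` be globally minimal with `W[2]` irreducible, `t` an odd prime, `v` the place over `t`, `𝔓` a prime of
`\bar ℤ` over `v`, and suppose `W` has good or multiplicative reduction at `v`.  Let `ζ` be a primitive `t^{m+1}`-th root of unity
such that the inertia group `I_𝔓 ≤ Γ_ℚ` acts transitively on the conjugates of `ζ` («`ℚ(ζ)` is totally ramified at `t`», element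
form).  Then some `g ∈ Γ_ℚ` fixes `ζ` and moves a point of `W[2]`.  Proof: otherwise `Stab(ζ)` acts trivially on `W[2]`; commutators
fix `ζ`, so `Γ_ℚ` acts on `W[2]` through an abelian group containing the `3`-cycle of a fixed-point-free `τ`, whence every element
with a non-zero fixed point acts trivially; inertia elements have non-zero fixed points (good: Néron–Ogg–Shafarevich
`smul_geomTorsion_eq_of_mem_inertia`; multiplicative: unipotence `smul_smul_sub_eq_of_mem_inertia_geomPoints`), so `I_𝔓` acts
trivially; but `I_𝔓 · Stab(ζ) ∋ τ` by transitivity — contradiction. [cite: Serre1972, §4] -/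
theorem exists_smul_eq_and_smul_ne_of_inertia_transitive (W : WeierstrassCurve ℚ) [W.IsElliptic]
    (hirr : W.HasIrreducibleModPGaloisRep 2) {t : ℕ} (ht : t.Prime) (ht2 : t ≠ 2)
    {v : HeightOneSpectrum (𝓞 ℚ)} (hv : (t : 𝓞 ℚ) ∈ v.asIdeal)
    (hred : W.HasGoodReductionAt v ∨ W.HasMultiplicativeReductionAt v)
    {𝔓 : Ideal (absIntegers (𝓞 ℚ) ℚ)} (h𝔓 : 𝔓 ∈ v.primesAbove) {m : ℕ} {ζ : AlgebraicClosure ℚ}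
    (hζ : IsPrimitiveRoot ζ (t ^ (m + 1)))
    (hTR : ∀ g : absoluteGaloisGroup ℚ, ∃ i ∈ 𝔓.inertia (absoluteGaloisGroup ℚ), i • ζ = g • ζ) :
    ∃ g : absoluteGaloisGroup ℚ, g • ζ = ζ ∧ ∃ P : W.geomTorsion ((2 : ℕ) : ℤ), g • P ≠ P := by
  classical
  haveI : Fact (Nat.Prime 2) := ⟨Nat.prime_two⟩
  have hq : 0 < t ^ (m + 1) := pow_pos ht.pos _
  haveI : NeZero (t ^ (m + 1)) := ⟨hq.ne'⟩
  by_contra hcon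
  push Not at hcon
  -- `hcon : ∀ g, g • ζ = ζ → ∀ P, g • P = P`
  -- (0) a fixed-point-free `τ`, the structure of `W[2]`
  obtain ⟨τ, hτ⟩ : ∃ τ : absoluteGaloisGroup ℚ, ∀ P : W.geomTorsion ((2 : ℕ) : ℤ), P ≠ 0 → τ • P ≠ P := by
    by_contra h
    push Not at h
    exact not_irreducible_of_forall_exists_smul_eq W 2 h hirr
  have h2 : ∀ P : W.geomTorsion ((2 : ℕ) : ℤ), P + P = 0 := by
    intro P
    have hP : ((2 : ℕ) : ℤ) • (P : W.geomPoints) = 0 := by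
      simpa only [AddSubgroup.torsionBy, Submodule.mem_toAddSubgroup, Submodule.mem_torsionBy_iff] using P.2
    apply Subtype.ext
    show (P : W.geomPoints) + P = 0
    rw [← two_zsmul]
    exact_mod_cast hP
  have hcard : Nat.card (W.geomTorsion ((2 : ℕ) : ℤ)) = 4 :=
    card_torsionPoints_eq_sq_holds W (AlgebraicClosure ℚ) (n := 2) (by exact_mod_cast (two_ne_zero : (2 : ℕ) ≠ 0))
  -- (1) every `g` sends `ζ` to a power of `ζ`; commutators fix `ζ`; hence `g τ = τ g` on `W[2]`
  have hpow : ∀ g : absoluteGaloisGroup ℚ, ∃ a : ℕ, g • ζ = ζ ^ a := by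
    intro g
    have hg : (g • ζ) ^ t ^ (m + 1) = 1 := by rw [← smul_pow', hζ.pow_eq_one, smul_one]
    obtain ⟨a, -, ha⟩ := hζ.eq_pow_of_pow_eq_one hg
    exact ⟨a, ha.symm⟩
  have hcomm : ∀ (g : absoluteGaloisGroup ℚ) (P : W.geomTorsion ((2 : ℕ) : ℤ)), g • τ • P = τ • g • P := by
    intro g P
    obtain ⟨a, ha⟩ := hpow g
    obtain ⟨b, hb⟩ := hpow τ
    have e12 : (g * τ) • ζ = (τ * g) • ζ := by
      rw [mul_smul, mul_smul, hb, smul_pow', ha, smul_pow', hb, ← pow_mul, ← pow_mul, mul_comm]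
    have hfix : (g * τ * (τ * g)⁻¹) • ζ = ζ := by
      obtain ⟨c, hc⟩ := hpow (τ * g)⁻¹
      rw [mul_smul, hc, smul_pow', e12, ← smul_pow', ← hc, smul_inv_smul]
    have h := hcon _ hfix (((τ * g) : absoluteGaloisGroup ℚ) • P)
    rw [mul_smul, inv_smul_smul, mul_smul, mul_smul] at h
    exact h
  -- (2) an element commuting with `τ` and fixing a non-zero point acts trivially
  have htriv : ∀ g : absoluteGaloisGroup ℚ, (∃ P : W.geomTorsion ((2 : ℕ) : ℤ), P ≠ 0 ∧ g • P = P) →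
      ∀ P : W.geomTorsion ((2 : ℕ) : ℤ), g • P = P := by
    rintro g ⟨v₀, hv₀, hgv₀⟩ P
    have hw : τ • v₀ ≠ 0 := fun h ↦ hv₀ ((smul_eq_zero_iff_eq τ).mp h)
    have hwv : τ • v₀ ≠ v₀ := hτ v₀ hv₀
    have hgw : g • τ • v₀ = τ • v₀ := by rw [hcomm, hgv₀]
    rcases eq_zero_or_eq_or_eq_or_eq_add h2 hcard hv₀ hw hwv P with rfl | rfl | rfl | rfl
    · exact smul_zero g
    · exact hgv₀
    · exact hgw
    · rw [smul_add, hgv₀, hgw]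
  -- (3) inertia acts trivially on `W[2]`
  have hvt : (Rat.HeightOneSpectrum.primesEquiv v : ℕ) = t := primesEquiv_eq_of_natCast_mem ht hv
  have h2v : ((2 : ℕ) : 𝓞 ℚ) ∉ v.asIdeal := fun h ↦
    ht2 (hvt.symm.trans (primesEquiv_eq_of_natCast_mem Nat.prime_two h))
  have hinert : ∀ i ∈ 𝔓.inertia (absoluteGaloisGroup ℚ), ∀ P : W.geomTorsion ((2 : ℕ) : ℤ), i • P = P := by
    intro i hi
    rcases hred with hgood | hmult
    · intro P
      exact W.smul_geomTorsion_eq_of_mem_inertia hgood (n := ((2 : ℕ) : ℤ)) (by exact_mod_cast h2v) h𝔓 hi P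
    · -- unipotence: `i` fixes `i P - P`; if that is non-zero, `i` is trivial by (2); else `i P = P`
      intro P
      by_contra hne
      have hunip : i • (i • P - P) = i • P - P := by
        apply Subtype.ext
        have hP : 2 ^ 1 • (P : W.geomPoints) = 0 := by
          rw [pow_one, ← natCast_zsmul]
          simpa only [AddSubgroup.torsionBy, Submodule.mem_toAddSubgroup, Submodule.mem_torsionBy_iff] using P.2
        simpa only [AddSubgroupClass.coe_sub, AddSubgroup.torsionBy.coe_smul] using
          W.smul_smul_sub_eq_of_mem_inertia_geomPoints hmult Nat.prime_two h2v le_rfl h𝔓 hi hP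
      have hQ : i • P - P ≠ 0 := fun h0 ↦ hne (sub_eq_zero.mp h0)
      exact hne (htriv i ⟨i • P - P, hQ, hunip⟩ P)
  -- (4) transitivity of inertia on the conjugates of `ζ`: `τ = i · g` with `g ∈ Stab ζ`
  obtain ⟨i, hi, hiζ⟩ := hTR τ
  have hgζ : (i⁻¹ * τ) • ζ = ζ := by rw [mul_smul, ← hiζ, inv_smul_smul]
  haveI : Finite (W.geomTorsion ((2 : ℕ) : ℤ)) := Nat.finite_of_card_ne_zero (by rw [hcard]; norm_num)
  haveI : Nontrivial (W.geomTorsion ((2 : ℕ) : ℤ)) := Finite.one_lt_card_iff_nontrivial.mp (by rw [hcard]; norm_num)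
  obtain ⟨P, hP⟩ := exists_ne (0 : W.geomTorsion ((2 : ℕ) : ℤ))
  apply hτ P hP
  have h1 := hcon _ hgζ P
  rw [mul_smul, inv_smul_eq_iff] at h1
  rw [h1, hinert i hi P]

end TheoremD

/-! ### §2  E-es-40's conclusion at an odd prime `t` of good or multiplicative reduction, modulo total ramification -/

section Assembly

/-- **E-es-40 at an odd prime `t` where `W` is good or multiplicative, from the total ramification of `ℚ(ζ_{t^{M+1}})` at `t`
(element form: the inertia group at a prime of `\bar ℤ` over `t` acts transitively on the conjugates of a primitive
`t^{M+1}`-th root of unity).**  For `W` globally minimal with `W[2]` irreducible: primes `r ∉ S`, `r ≡ 1 (mod t^M)`, with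
`a_r(W)` odd.  Theorem D + Theorem C (p613173) + Theorem A (p612387).  The clause `t = 2 ∨ t² ∤ N` of the leaf E-es-40 enters
only through the hypothesis «good or multiplicative at `t`» (`t ∤ N`: good; `t ∥ N`: `a_t(f) = ±1`, Atkin–Lehner, so not
additive). [cite: TateGCFT1967, §2.4 (Tchebotarev density theorem)] -/
theorem exists_prime_modEq_one_lFunction_odd_of_inertia_transitive (W : WeierstrassCurve ℚ) [W.IsElliptic]
    [W.IsGloballyMinimal] (hirr : W.HasIrreducibleModPGaloisRep 2) {t : ℕ} (ht : t.Prime) (ht2 : t ≠ 2)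
    {v : HeightOneSpectrum (𝓞 ℚ)} (hv : (t : 𝓞 ℚ) ∈ v.asIdeal)
    (hred : W.HasGoodReductionAt v ∨ W.HasMultiplicativeReductionAt v)
    {𝔓 : Ideal (absIntegers (𝓞 ℚ) ℚ)} (h𝔓 : 𝔓 ∈ v.primesAbove) (S : Finset ℕ) (M : ℕ)
    (hTR : ∀ ζ : AlgebraicClosure ℚ, IsPrimitiveRoot ζ (t ^ (M + 1)) →
      ∀ g : absoluteGaloisGroup ℚ, ∃ i ∈ 𝔓.inertia (absoluteGaloisGroup ℚ), i • ζ = g • ζ) :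
    ∃ r : ℕ, r.Prime ∧ r ∉ S ∧ r ≡ 1 [MOD t ^ M] ∧ (((W.LFunction r : ℤ) : ZMod 2)) ≠ (r : ZMod 2) + 1 := by
  classical
  obtain ⟨r, hr, hrS, _, hmod, hgood, hodd⟩ :=
    exists_prime_modEq_one_reductionPointCount_odd_of_exists_smul_ne W hirr ht S M fun ζ hζ ↦
      exists_smul_eq_and_smul_ne_of_inertia_transitive W hirr ht ht2 hv hred h𝔓 hζ (hTR ζ hζ)
  refine ⟨r, hr.out, hrS, ?_, ?_⟩
  · rw [pow_succ'] at hmod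
    exact Nat.ModEq.of_mul_left t hmod
  · rw [WeierstrassCurve.LFunction_apply_prime_eq_frobeniusTrace W r hgood]
    intro heq
    apply hodd
    have h2 : ((((r : ℤ) + 1 : ℤ)) : ZMod 2) = ((W.frobeniusTrace r : ℤ) : ZMod 2) := by
      rw [heq]; push_cast; ring
    have h3 := (ZMod.intCast_eq_intCast_iff_dvd_sub ((r : ℤ) + 1) (W.frobeniusTrace r) 2).mp h2
    exact (dvd_frobeniusTrace_sub_iff W 2 r).mp (by exact_mod_cast h3)

end Assembly

end Summit.BirchSwinnertonDyer.BirchSwinnertonDyer.Theorems.ManinLocalTwoThree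

end
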